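import Mathlib
import Summits.ResolutionOfSingularities.ResolutionOfSingularities.Theses.WeightedInvariant
import Literature.AlgebraicGeometry.Resolution.CobordantGame
import Literature.AlgebraicGeometry.Resolution.CobordantChartCoefficients
import Literature.AlgebraicGeometry.Resolution.AxisPolyhedron
import Summits.ResolutionOfSingularities.ResolutionOfSingularities.Theorems.WeightedInvariantLocalWeightedDropTameLift
import Summits.ResolutionOfSingularities.ResolutionOfSingularities.Theorems.WeightedInvariantLocalWeightedDropAxisCut

/-!
# `LocalWeightedDrop`, line `hasse-ridge-face-selection`: surfaces are won modulo the two wild surface pieces S2, S3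

Route `ResolutionOfSingularities/WeightedInvariant`, crux `LocalWeightedDrop` (stmt-ResolutionOfSingularities-8899), line
`hasse-ridge-face-selection`, skeleton v20 (chain w43, [OURS · L1 W4.3]).  With the axis cut closed (`…LocalWeightedDropAxisCut`),
the residual wild core W″ splits by starting dimension into the registered stubs
S2 `stub_charTwoDoublePointSurfaceWon` (N = 3, p = d = 2: char-2 surface double points, Hauser's kangaroo `x² + y⁷ + yz⁴`),
S3 `stub_wildUnaryConeSurfaceWon` (N = 3, `p ∣ d ≥ 3`, unary tangent cone `ℓ^d`: Moh / purely inseparable territory),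
W4 `stub_wildWideApexHigherStartsWon` (N ≥ 4); all are taken here as HYPOTHESES with their registered signatures.
* `wildWideApexStartsWon_of_split` — S2 ∧ S3 ∧ W4 reassemble CORE W″ of v18 verbatim (the axis-case hypothesis of S3 is
  discharged by `AxisCut.axisStartsWon`);
* `surfaceGermsWon_of_pieces` — THE N = 3 MILESTONE: S2 → S3 → every singular surface germ `f ∈ k[[x, y, z]]` over an
  algebraically closed field of characteristic `p` is won in the local weighted resolution game (its only non-kernel inputs
  are the two hypotheses; the `N ≥ 4` cores are not used);
* `localWeightedDrop_of_pieces` — S2 → S3 → W4 → T″ → `LocalWeightedDrop`.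
Deliberately NOT here: any claim about S2, S3, W4, T″ themselves (open mathematics as positional weighted strategies).
-/

set_option linter.dupNamespace false -- mandated namespace of this single-conjunct summit

namespace Summit.ResolutionOfSingularities.ResolutionOfSingularities.Theorems

open Literature.AlgebraicGeometry.Resolution

/-- GLUE (kernel-checked, no `sorry`): the three pieces reassemble CORE W″ of v18 verbatim — case split on the starting
dimension `n + 3 = 3` vs `≥ 4` and, in three variables, on `d = 2` (then `p = 2`) vs `d > 2`; the axis-case hypothesis of S3 is
discharged by `AxisCut.axisStartsWon` (hence by B1, B2 and the landed B3–B5). -/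
theorem wildWideApexStartsWon_of_split
    (hS2 : ∀ (k : Type) [Field k] [CharP k 2] [IsAlgClosed k],
      (∀ m : ℕ, m < 3 → ∀ g : MvPowerSeries (Fin m) k,
        CobordantGame.IsSingular k g → CobordantGame.Won k m g) →
      ∀ (f : MvPowerSeries (Fin 3) k), CobordantGame.IsSingular k f →
      (∀ g : MvPowerSeries (Fin 3) k, CobordantGame.IsSingular k g → g.order < f.order →
        CobordantGame.Won k 3 g) →
      f.order = 2 →
      (∃ ℓ : Fin 3 → k, ∀ i j : Fin 3,
        MvPowerSeries.coeff (Finsupp.single i 1 + Finsupp.single j 1) f =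
          MvPowerSeries.coeff (Finsupp.single i 1 + Finsupp.single j 1)
            ((∑ l, MvPowerSeries.C (ℓ l) * MvPowerSeries.X l) ^ 2)) →
      CobordantGame.Won k 3 f)
    (hS3 : ∀ (p : ℕ), p.Prime → ∀ (k : Type) [Field k] [CharP k p] [IsAlgClosed k],
      (∀ m : ℕ, m < 3 → ∀ g : MvPowerSeries (Fin m) k,
        CobordantGame.IsSingular k g → CobordantGame.Won k m g) →
      ∀ (f : MvPowerSeries (Fin 3) k), CobordantGame.IsSingular k f →
      (∀ g : MvPowerSeries (Fin 3) k, CobordantGame.IsSingular k g → g.order < f.order →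
        CobordantGame.Won k 3 g) →
      ∀ (d : ℕ), f.order = d → p ∣ d → 2 < d →
      (∀ g : MvPowerSeries (Fin 3) k, CobordantGame.IsSingular k g → g.order = d →
        (∃ c : Fin 3 → k, c ≠ 0 ∧ ∀ v : Fin 3 → k,
          CobordantChart.initEval (fun _ : Fin 3 => 1) (v + c) d g =
            CobordantChart.initEval (fun _ : Fin 3 => 1) v d g) →
        (∀ c₁ c₂ : Fin 3 → k,
          (∀ v : Fin 3 → k, CobordantChart.initEval (fun _ : Fin 3 => 1) (v + c₁) d g =
            CobordantChart.initEval (fun _ : Fin 3 => 1) v d g) →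
          (∀ v : Fin 3 → k, CobordantChart.initEval (fun _ : Fin 3 => 1) (v + c₂) d g =
            CobordantChart.initEval (fun _ : Fin 3 => 1) v d g) →
          ∃ α β : k, (α ≠ 0 ∨ β ≠ 0) ∧ α • c₁ + β • c₂ = 0) →
        CobordantGame.Won k 3 g) →
      (∃ c₁ c₂ : Fin 3 → k, (∀ α β : k, α • c₁ + β • c₂ = 0 → α = 0 ∧ β = 0) ∧
        (∀ v : Fin 3 → k, CobordantChart.initEval (fun _ : Fin 3 => 1) (v + c₁) d f =
          CobordantChart.initEval (fun _ : Fin 3 => 1) v d f) ∧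
        (∀ v : Fin 3 → k, CobordantChart.initEval (fun _ : Fin 3 => 1) (v + c₂) d f =
          CobordantChart.initEval (fun _ : Fin 3 => 1) v d f)) →
      CobordantGame.Won k 3 f)
    (hW4 : ∀ (p : ℕ), p.Prime → ∀ (k : Type) [Field k] [CharP k p] [IsAlgClosed k]
      (n : ℕ), (∀ m : ℕ, m < n + 4 → ∀ g : MvPowerSeries (Fin m) k,
        CobordantGame.IsSingular k g → CobordantGame.Won k m g) →
      ∀ (f : MvPowerSeries (Fin (n + 4)) k), CobordantGame.IsSingular k f →
      (∀ g : MvPowerSeries (Fin (n + 4)) k, CobordantGame.IsSingular k g → g.order < f.order →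
        CobordantGame.Won k (n + 4) g) →
      ∀ (d : ℕ), f.order = d → p ∣ d →
      (∃ ℓ : Fin (n + 4) → k, ∀ i j : Fin (n + 4),
        MvPowerSeries.coeff (Finsupp.single i 1 + Finsupp.single j 1) f =
          MvPowerSeries.coeff (Finsupp.single i 1 + Finsupp.single j 1)
            ((∑ l, MvPowerSeries.C (ℓ l) * MvPowerSeries.X l) ^ 2)) →
      (2 < d → ∃ c₁ c₂ : Fin (n + 4) → k, (∀ α β : k, α • c₁ + β • c₂ = 0 → α = 0 ∧ β = 0) ∧
        (∀ v : Fin (n + 4) → k, CobordantChart.initEval (fun _ : Fin (n + 4) => 1) (v + c₁) d f =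
          CobordantChart.initEval (fun _ : Fin (n + 4) => 1) v d f) ∧
        (∀ v : Fin (n + 4) → k, CobordantChart.initEval (fun _ : Fin (n + 4) => 1) (v + c₂) d f =
          CobordantChart.initEval (fun _ : Fin (n + 4) => 1) v d f)) →
      CobordantGame.Won k (n + 4) f) :
    ∀ (p : ℕ), p.Prime → ∀ (k : Type) [Field k] [CharP k p] [IsAlgClosed k]
    (n : ℕ), (∀ m : ℕ, m < n + 3 → ∀ g : MvPowerSeries (Fin m) k,
      CobordantGame.IsSingular k g → CobordantGame.Won k m g) →
    ∀ (f : MvPowerSeries (Fin (n + 3)) k), CobordantGame.IsSingular k f →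
    (∀ g : MvPowerSeries (Fin (n + 3)) k, CobordantGame.IsSingular k g → g.order < f.order →
      CobordantGame.Won k (n + 3) g) →
    ∀ (d : ℕ), f.order = d → p ∣ d →
    (∃ ℓ : Fin (n + 3) → k, ∀ i j : Fin (n + 3),
      MvPowerSeries.coeff (Finsupp.single i 1 + Finsupp.single j 1) f =
        MvPowerSeries.coeff (Finsupp.single i 1 + Finsupp.single j 1)
          ((∑ l, MvPowerSeries.C (ℓ l) * MvPowerSeries.X l) ^ 2)) →
    (2 < d → ∃ c₁ c₂ : Fin (n + 3) → k, (∀ α β : k, α • c₁ + β • c₂ = 0 → α = 0 ∧ β = 0) ∧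
      (∀ v : Fin (n + 3) → k, CobordantChart.initEval (fun _ : Fin (n + 3) => 1) (v + c₁) d f =
        CobordantChart.initEval (fun _ : Fin (n + 3) => 1) v d f) ∧
      (∀ v : Fin (n + 3) → k, CobordantChart.initEval (fun _ : Fin (n + 3) => 1) (v + c₂) d f =
        CobordantChart.initEval (fun _ : Fin (n + 3) => 1) v d f)) →
    CobordantGame.Won k (n + 3) f := by
  intro p hp k _ _ _ n
  cases n with
  | zero =>
    intro IH f hf hord d hd hpd hsq hwide
    have h2 : (2 : ℕ∞) ≤ f.order := (FormalCoordChange.two_le_order_iff f).mpr hf.2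
    rw [hd] at h2
    have h2' : 2 ≤ d := by exact_mod_cast h2
    by_cases hd2 : d = 2
    · subst hd2
      have hp2 : p = 2 := (Nat.prime_dvd_prime_iff_eq hp Nat.prime_two).mp hpd
      subst hp2
      exact hS2 k IH f hf hord hd hsq
    · refine hS3 p hp k IH f hf hord d hd hpd (by omega) (fun g hg hgd hone hcol => ?_) (hwide (by omega))
      have hordg : ∀ g' : MvPowerSeries (Fin 3) k, CobordantGame.IsSingular k g' → g'.order < g.order →
          CobordantGame.Won k 3 g' := fun g' hg' hlt => hord g' hg' (by rw [hd, ← hgd]; exact hlt)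
      exact AxisCut.axisStartsWon p hp k 0 g hg hordg d hgd (by omega) hone hcol
  | succ n => exact hW4 p hp k n



/-- THE N = 3 MILESTONE of chain w43 (kernel-checked; its `sorry`-cone is EXACTLY {B1 `stub_axisPreparation`,
B2 `stub_axisWeightedMove`} ∪ the two hypotheses — NOT the `N ≥ 4` cores W4 / T″): the two wild surface pieces S2, S3
(together with the axis cut) win EVERY SINGULAR SURFACE GERM over an algebraically closed field of characteristic `p`,
i.e. give a positional weighted resolution strategy for all hypersurface surface singularities `f ∈ k[[x,y,z]]`.
[OURS · L1 W4.3] -/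
theorem surfaceGermsWon_of_pieces
    (hS2 : ∀ (k : Type) [Field k] [CharP k 2] [IsAlgClosed k],
      (∀ m : ℕ, m < 3 → ∀ g : MvPowerSeries (Fin m) k,
        CobordantGame.IsSingular k g → CobordantGame.Won k m g) →
      ∀ (f : MvPowerSeries (Fin 3) k), CobordantGame.IsSingular k f →
      (∀ g : MvPowerSeries (Fin 3) k, CobordantGame.IsSingular k g → g.order < f.order →
        CobordantGame.Won k 3 g) →
      f.order = 2 →
      (∃ ℓ : Fin 3 → k, ∀ i j : Fin 3,
        MvPowerSeries.coeff (Finsupp.single i 1 + Finsupp.single j 1) f =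
          MvPowerSeries.coeff (Finsupp.single i 1 + Finsupp.single j 1)
            ((∑ l, MvPowerSeries.C (ℓ l) * MvPowerSeries.X l) ^ 2)) →
      CobordantGame.Won k 3 f)
    (hS3 : ∀ (p : ℕ), p.Prime → ∀ (k : Type) [Field k] [CharP k p] [IsAlgClosed k],
      (∀ m : ℕ, m < 3 → ∀ g : MvPowerSeries (Fin m) k,
        CobordantGame.IsSingular k g → CobordantGame.Won k m g) →
      ∀ (f : MvPowerSeries (Fin 3) k), CobordantGame.IsSingular k f →
      (∀ g : MvPowerSeries (Fin 3) k, CobordantGame.IsSingular k g → g.order < f.order →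
        CobordantGame.Won k 3 g) →
      ∀ (d : ℕ), f.order = d → p ∣ d → 2 < d →
      (∀ g : MvPowerSeries (Fin 3) k, CobordantGame.IsSingular k g → g.order = d →
        (∃ c : Fin 3 → k, c ≠ 0 ∧ ∀ v : Fin 3 → k,
          CobordantChart.initEval (fun _ : Fin 3 => 1) (v + c) d g =
            CobordantChart.initEval (fun _ : Fin 3 => 1) v d g) →
        (∀ c₁ c₂ : Fin 3 → k,
          (∀ v : Fin 3 → k, CobordantChart.initEval (fun _ : Fin 3 => 1) (v + c₁) d g =
            CobordantChart.initEval (fun _ : Fin 3 => 1) v d g) →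
          (∀ v : Fin 3 → k, CobordantChart.initEval (fun _ : Fin 3 => 1) (v + c₂) d g =
            CobordantChart.initEval (fun _ : Fin 3 => 1) v d g) →
          ∃ α β : k, (α ≠ 0 ∨ β ≠ 0) ∧ α • c₁ + β • c₂ = 0) →
        CobordantGame.Won k 3 g) →
      (∃ c₁ c₂ : Fin 3 → k, (∀ α β : k, α • c₁ + β • c₂ = 0 → α = 0 ∧ β = 0) ∧
        (∀ v : Fin 3 → k, CobordantChart.initEval (fun _ : Fin 3 => 1) (v + c₁) d f =
          CobordantChart.initEval (fun _ : Fin 3 => 1) v d f) ∧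
        (∀ v : Fin 3 → k, CobordantChart.initEval (fun _ : Fin 3 => 1) (v + c₂) d f =
          CobordantChart.initEval (fun _ : Fin 3 => 1) v d f)) →
      CobordantGame.Won k 3 f)
    (p : ℕ) (hp : p.Prime) (k : Type) [Field k] [CharP k p] [IsAlgClosed k] :
    ∀ (f : MvPowerSeries (Fin 3) k), CobordantGame.IsSingular k f → CobordantGame.Won k 3 f := by
  open Literature.AlgebraicGeometry.Resolution.CobordantGame in
  have IH : ∀ m : ℕ, m < 3 → ∀ g : MvPowerSeries (Fin m) k, IsSingular k g → Won k m g := by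
    intro m hm g hg
    match m, hm, g, hg with
    | 0, _, g, hg => exact absurd hg (PlaneWon.not_isSingular_fin_zero g)
    | 1, _, g, hg => exact PlaneWon.lineWon g hg
    | 2, _, g, hg => exact stub_planeWon k g hg
    | m + 3, hm, _, _ => exact absurd hm (by omega)
  suffices key : ∀ (d : ℕ) (f : MvPowerSeries (Fin 3) k), f.order = d → IsSingular k f → Won k 3 f by
    intro f hf
    exact key _ f ((MvPowerSeries.ne_zero_iff_order_finite).mp hf.1).symm hf
  intro d
  induction d using Nat.strong_induction_on with
  | _ d IHd =>
    intro f hfd hf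
    have hord : ∀ g : MvPowerSeries (Fin 3) k, IsSingular k g → g.order < f.order → Won k 3 g := by
      intro g hg hlt
      have hgo : (g.order.toNat : ℕ∞) = g.order := (MvPowerSeries.ne_zero_iff_order_finite).mp hg.1
      refine IHd g.order.toNat ?_ g hgo.symm hg
      have : (g.order.toNat : ℕ∞) < (d : ℕ∞) := by rw [hgo, ← hfd]; exact hlt
      exact_mod_cast this
    rcases stub_coneDichotomy k 1 f hf with hhyp | ⟨ℓ, hℓ⟩
    · exact TangentConeCut.hyperbolicStartsWon (fun g hg => IH 1 (by omega) g hg) f hf hhyp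
    · refine AxisCut.coneStartsWon_local p hp k 0 f hf hord ℓ hℓ d hfd (fun hpd hcyl => ?_)
        (fun hn _ _ => absurd hn (lt_irrefl 0))
      have h2 : (2 : ℕ∞) ≤ f.order := (FormalCoordChange.two_le_order_iff f).mpr hf.2
      rw [hfd] at h2
      have h2' : 2 ≤ d := by exact_mod_cast h2
      by_cases hd2 : d = 2
      · subst hd2
        have hp2 : p = 2 := (Nat.prime_dvd_prime_iff_eq hp Nat.prime_two).mp hpd
        subst hp2
        exact hS2 k IH f hf hord hfd ⟨ℓ, hℓ⟩
      · refine hS3 p hp k IH f hf hord d hfd hpd (by omega) (fun g hg hgd hone hcol => ?_) (hcyl (by omega))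
        have hordg : ∀ g' : MvPowerSeries (Fin 3) k, IsSingular k g' → g'.order < g.order → Won k 3 g' :=
          fun g' hg' hlt => hord g' hg' (by rw [hfd, ← hgd]; exact hlt)
        exact AxisCut.axisStartsWon p hp k 0 g hg hordg d hgd (by omega) hone hcol

/-- THE CRUX FROM THE FOUR RESIDUAL PIECES (skeleton v20 of the line, kernel-checked glue): S2 → S3 → W4 → T″ →
`LocalWeightedDrop`, by the inductive normal form `localWeightedDrop_iff_allWon` and `AxisCut.higherStartsWon`. -/
theorem localWeightedDrop_of_pieces
    (hS2 : ∀ (k : Type) [Field k] [CharP k 2] [IsAlgClosed k],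
      (∀ m : ℕ, m < 3 → ∀ g : MvPowerSeries (Fin m) k,
        CobordantGame.IsSingular k g → CobordantGame.Won k m g) →
      ∀ (f : MvPowerSeries (Fin 3) k), CobordantGame.IsSingular k f →
      (∀ g : MvPowerSeries (Fin 3) k, CobordantGame.IsSingular k g → g.order < f.order →
        CobordantGame.Won k 3 g) →
      f.order = 2 →
      (∃ ℓ : Fin 3 → k, ∀ i j : Fin 3,
        MvPowerSeries.coeff (Finsupp.single i 1 + Finsupp.single j 1) f =
          MvPowerSeries.coeff (Finsupp.single i 1 + Finsupp.single j 1)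
            ((∑ l, MvPowerSeries.C (ℓ l) * MvPowerSeries.X l) ^ 2)) →
      CobordantGame.Won k 3 f)
    (hS3 : ∀ (p : ℕ), p.Prime → ∀ (k : Type) [Field k] [CharP k p] [IsAlgClosed k],
      (∀ m : ℕ, m < 3 → ∀ g : MvPowerSeries (Fin m) k,
        CobordantGame.IsSingular k g → CobordantGame.Won k m g) →
      ∀ (f : MvPowerSeries (Fin 3) k), CobordantGame.IsSingular k f →
      (∀ g : MvPowerSeries (Fin 3) k, CobordantGame.IsSingular k g → g.order < f.order →
        CobordantGame.Won k 3 g) →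
      ∀ (d : ℕ), f.order = d → p ∣ d → 2 < d →
      (∀ g : MvPowerSeries (Fin 3) k, CobordantGame.IsSingular k g → g.order = d →
        (∃ c : Fin 3 → k, c ≠ 0 ∧ ∀ v : Fin 3 → k,
          CobordantChart.initEval (fun _ : Fin 3 => 1) (v + c) d g =
            CobordantChart.initEval (fun _ : Fin 3 => 1) v d g) →
        (∀ c₁ c₂ : Fin 3 → k,
          (∀ v : Fin 3 → k, CobordantChart.initEval (fun _ : Fin 3 => 1) (v + c₁) d g =
            CobordantChart.initEval (fun _ : Fin 3 => 1) v d g) →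
          (∀ v : Fin 3 → k, CobordantChart.initEval (fun _ : Fin 3 => 1) (v + c₂) d g =
            CobordantChart.initEval (fun _ : Fin 3 => 1) v d g) →
          ∃ α β : k, (α ≠ 0 ∨ β ≠ 0) ∧ α • c₁ + β • c₂ = 0) →
        CobordantGame.Won k 3 g) →
      (∃ c₁ c₂ : Fin 3 → k, (∀ α β : k, α • c₁ + β • c₂ = 0 → α = 0 ∧ β = 0) ∧
        (∀ v : Fin 3 → k, CobordantChart.initEval (fun _ : Fin 3 => 1) (v + c₁) d f =
          CobordantChart.initEval (fun _ : Fin 3 => 1) v d f) ∧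
        (∀ v : Fin 3 → k, CobordantChart.initEval (fun _ : Fin 3 => 1) (v + c₂) d f =
          CobordantChart.initEval (fun _ : Fin 3 => 1) v d f)) →
      CobordantGame.Won k 3 f)
    (hW4 : ∀ (p : ℕ), p.Prime → ∀ (k : Type) [Field k] [CharP k p] [IsAlgClosed k]
      (n : ℕ), (∀ m : ℕ, m < n + 4 → ∀ g : MvPowerSeries (Fin m) k,
        CobordantGame.IsSingular k g → CobordantGame.Won k m g) →
      ∀ (f : MvPowerSeries (Fin (n + 4)) k), CobordantGame.IsSingular k f →
      (∀ g : MvPowerSeries (Fin (n + 4)) k, CobordantGame.IsSingular k g → g.order < f.order →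
        CobordantGame.Won k (n + 4) g) →
      ∀ (d : ℕ), f.order = d → p ∣ d →
      (∃ ℓ : Fin (n + 4) → k, ∀ i j : Fin (n + 4),
        MvPowerSeries.coeff (Finsupp.single i 1 + Finsupp.single j 1) f =
          MvPowerSeries.coeff (Finsupp.single i 1 + Finsupp.single j 1)
            ((∑ l, MvPowerSeries.C (ℓ l) * MvPowerSeries.X l) ^ 2)) →
      (2 < d → ∃ c₁ c₂ : Fin (n + 4) → k, (∀ α β : k, α • c₁ + β • c₂ = 0 → α = 0 ∧ β = 0) ∧
        (∀ v : Fin (n + 4) → k, CobordantChart.initEval (fun _ : Fin (n + 4) => 1) (v + c₁) d f =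
          CobordantChart.initEval (fun _ : Fin (n + 4) => 1) v d f) ∧
        (∀ v : Fin (n + 4) → k, CobordantChart.initEval (fun _ : Fin (n + 4) => 1) (v + c₂) d f =
          CobordantChart.initEval (fun _ : Fin (n + 4) => 1) v d f)) →
      CobordantGame.Won k (n + 4) f)
    (hT : ∀ (p : ℕ), p.Prime → ∀ (k : Type) [Field k] [CharP k p] [IsAlgClosed k]
    (n : ℕ), (∀ m : ℕ, m < n + 4 → ∀ g : MvPowerSeries (Fin m) k,
      CobordantGame.IsSingular k g → CobordantGame.Won k m g) →
    ∀ (f : MvPowerSeries (Fin (n + 4)) k), CobordantGame.IsSingular k f →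
    (∀ g : MvPowerSeries (Fin (n + 4)) k, CobordantGame.IsSingular k g → g.order < f.order →
      CobordantGame.Won k (n + 4) g) →
    ∀ (d : ℕ), f.order = d → ¬ p ∣ d →
    (∃ ℓ : Fin (n + 4) → k, ∀ i j : Fin (n + 4),
      MvPowerSeries.coeff (Finsupp.single i 1 + Finsupp.single j 1) f =
        MvPowerSeries.coeff (Finsupp.single i 1 + Finsupp.single j 1)
          ((∑ l, MvPowerSeries.C (ℓ l) * MvPowerSeries.X l) ^ 2)) →
    (2 < d → ∃ c₁ c₂ : Fin (n + 4) → k, (∀ α β : k, α • c₁ + β • c₂ = 0 → α = 0 ∧ β = 0) ∧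
      (∀ v : Fin (n + 4) → k, CobordantChart.initEval (fun _ : Fin (n + 4) => 1) (v + c₁) d f =
        CobordantChart.initEval (fun _ : Fin (n + 4) => 1) v d f) ∧
      (∀ v : Fin (n + 4) → k, CobordantChart.initEval (fun _ : Fin (n + 4) => 1) (v + c₂) d f =
        CobordantChart.initEval (fun _ : Fin (n + 4) => 1) v d f)) →
    CobordantGame.Won k (n + 4) f) :
    Summit.ResolutionOfSingularities.ResolutionOfSingularities.Theses.WeightedInvariant.LocalWeightedDrop := by
  rw [localWeightedDrop_iff_allWon]
  intro p hp k _ _ _ n f hf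
  exact AxisCut.higherStartsWon (wildWideApexStartsWon_of_split hS2 hS3 hW4) hT p hp k n f hf

end Summit.ResolutionOfSingularities.ResolutionOfSingularities.Theorems
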